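import Summits.CriticalPhenomena.PercolationContinuityZ3.Theorems.PercAnnulusCrossingHarrisSlackBounds
import HarnessLib

/-!
# RSW3 lane (lead, gen 23): ANATOMY OF THE HARRIS SLACK, V — the variance as the noise integral of the pivotal autocorrelation,
# which decreases from the total influence (ε = 0) to the level-1 weight (ε = 1)

builds on p205010 (kernel theorem, internal audit signed; external expert review pending) — NOT used in this file (abstract).

Cell `prim-rsw3` (LANE 3), lead seat, gen 23.  Support file (`--supports stmt-CriticalPhenomena-4575`); no definitions, no named facts,
no sorries.  The diagonal case `g = f` of parts I–II: the PIVOTAL AUTOCORRELATION of `f` at noise level `ε` is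
`J_f(ε) = Σ_i p_i(1−p_i)·E[D_i f(ω)·D_i f(ω^ε)]` (for an increasing event: `p(1−p)`-weighted expected number of coordinates pivotal in `ω` AND in the
`ε`-noised copy).  Proved, every `p ∈ [0,1]^ι`, every real `f` (NO monotonicity needed in this part):

* **`var_eq_integral_pivotal_autocorrelation`** — `E[f²] − E[f]² = ∫_0^1 J_f(ε) dε`;
* `pivotal_autocorrelation_eq_sum_coeff_sq` — `J_f(ε) = Σ_S |S|(1−ε)^{|S|−1} f̂(S)²` (so `J_f ≥ 0` and `J_f` is non-increasing on `[0,1]`: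
  **`pivotal_autocorrelation_antitone`**, `pivotal_autocorrelation_nonneg`);
* the endpoints: **`pivotal_autocorrelation_zero`** — `J_f(0) = Σ_i p_i(1−p_i)E[(D_i f)²]` (the total influence in the pivotal currency, gen 21's
  mean spectral size `Σ_S |S| f̂(S)²`); **`pivotal_autocorrelation_one`** — `J_f(1) = Σ_i p_i(1−p_i)E[D_i f]²` (the level-1 weight `Σ_i f̂(i)²` for the
  p-biased characters);
* hence THE SANDWICH **`level_one_weight_le_var`** / **`var_le_total_influence`** — `Σ_i p_i(1−p_i)E[D_i f]² ≤ Var f ≤ Σ_i p_i(1−p_i)E[(D_i f)²]`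
  (the level-1 inequality and the Poincaré–Efron–Stein inequality as the two ends of one monotone interpolation; for an increasing event `A` of
  probability `u` on the lattice cube: `p(1−p)Σ_e P(e piv A)² ≤ u(1−u) ≤ p(1−p)E[N_piv(A)]`).
Noise sensitivity of a sequence `f_n` (gens 20–21) is the statement that `J_{f_n}` collapses immediately: `∫_ε^1 J_{f_n} → 0` for every `ε > 0`
while `∫_0^1 J_{f_n} = Var f_n` stays of order one.

References: M. Talagrand, Combinatorica 16 (1996) §2; R. O'Donnell, *Analysis of Boolean Functions*, CUP 2014, §2.3–2.4 (Poincaré, total influence,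
noise stability Stab_ρ = Σ ρ^{|S|}f̂²), §8.4 Prop 8.45; B. Efron, C. Stein, Ann. Stat. 9 (1981); C. Garban, J. Steif, CUP 2014, Ch. IV–V.
-/

noncomputable section

namespace Summit.CriticalPhenomena.PercolationContinuityZ3.Theorems.Crossing.Spectral

open Finset Function MeasureTheory intervalIntegral
open Literature.Probability.ODonnellSaksSchrammServedio2005

variable {ι : Type*} [Fintype ι] [DecidableEq ι] (p : ι → ℝ) (h0 : ∀ i, 0 ≤ p i) (h1 : ∀ i, p i ≤ 1)

include h0 h1 in
/-- **THE VARIANCE IS THE NOISE INTEGRAL OF THE PIVOTAL AUTOCORRELATION**: `E[f²] − E[f]² = ∫_0^1 Σ_i p_i(1−p_i)·E[D_i f(ω)·D_i f(ω^ε)] dε`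
(part I's `cov_eq_integral` with `g = f`). [cite: Talagrand1996, §2] [cite: ODonnell2014, §2.4 and §8.4 Prop 8.45] -/
theorem var_eq_integral_pivotal_autocorrelation (f : (ι → Bool) → ℝ) :
    ∑ x : ι → Bool, wt p x * (f x * f x) - (∑ x : ι → Bool, wt p x * f x) ^ 2
      = ∫ ε in (0 : ℝ)..1, ∑ i, p i * (1 - p i) * ∑ x : ι → Bool, ∑ y : ι → Bool, ∑ m : ι → Bool,
          wt p x * wt p y * wt (fun _ => ε) m
            * ((f (update x i true) - f (update x i false))
              * (f (update (fun j => if m j = true then y j else x j) i true)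
                - f (update (fun j => if m j = true then y j else x j) i false))) := by
  rw [sq, cov_eq_integral p h0 h1 f f]

include h0 h1 in
/-- **THE PIVOTAL AUTOCORRELATION, SPECTRALLY**: `J_f(ε) = Σ_S |S|(1−ε)^{|S|−1}·f̂(S)²` for the p-biased characters (part I's
`sum_bias_mul_deriv_noise_eq` with `g = f`). [cite: ODonnell2014, §2.4 Prop 2.47 (d/dρ Stab_ρ)] -/
theorem pivotal_autocorrelation_eq_sum_coeff_sq (f : (ι → Bool) → ℝ) (ε : ℝ) :
    ∑ i, p i * (1 - p i) * ∑ x : ι → Bool, ∑ y : ι → Bool, ∑ m : ι → Bool, wt p x * wt p y * wt (fun _ => ε) m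
        * ((f (update x i true) - f (update x i false))
          * (f (update (fun j => if m j = true then y j else x j) i true)
            - f (update (fun j => if m j = true then y j else x j) i false)))
      = ∑ S ∈ (Finset.univ : Finset ι).powerset, (S.card : ℝ) * ((1 - ε) ^ (S.card - 1)
          * (∑ x : ι → Bool, wt p x * (f x * ∏ j ∈ S,
              (((if x j then (1 : ℝ) else 0) - p j) / Real.sqrt (p j * (1 - p j))))) ^ 2) := by
  rw [sum_bias_mul_deriv_noise_eq (pbiased_H1 p) (pbiased_H2 p h0 h1) f f ε]
  refine Finset.sum_congr rfl fun S _ => ?_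
  ring

include h0 h1 in
/-- `J_f(ε) ≥ 0` for `ε ≤ 1` and every real `f`. [cite: ODonnell2014, §2.4 (Stab_ρ has nonnegative ρ-derivative for ρ ≥ 0)] -/
theorem pivotal_autocorrelation_nonneg (f : (ι → Bool) → ℝ) {ε : ℝ} (hε : ε ≤ 1) :
    0 ≤ ∑ i, p i * (1 - p i) * ∑ x : ι → Bool, ∑ y : ι → Bool, ∑ m : ι → Bool, wt p x * wt p y * wt (fun _ => ε) m
        * ((f (update x i true) - f (update x i false))
          * (f (update (fun j => if m j = true then y j else x j) i true)
            - f (update (fun j => if m j = true then y j else x j) i false))) := by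
  rw [pivotal_autocorrelation_eq_sum_coeff_sq p h0 h1 f ε]
  exact Finset.sum_nonneg fun S _ => mul_nonneg (Nat.cast_nonneg _)
    (mul_nonneg (pow_nonneg (by linarith) _) (sq_nonneg _))

include h0 h1 in
/-- **THE PIVOTAL AUTOCORRELATION IS NON-INCREASING IN THE NOISE** on `[0,1]`, for EVERY real `f` (all spectral terms `|S|(1−ε)^{|S|−1}f̂(S)²`
decrease), `a ≤ b ≤ 1`. [cite: ODonnell2014, §2.4 Prop 2.47] [cite: GarbanSteif2014, Ch. IV (1.4)] -/
theorem pivotal_autocorrelation_antitone (f : (ι → Bool) → ℝ) {a b : ℝ} (hab : a ≤ b) (hb : b ≤ 1) :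
    ∑ i, p i * (1 - p i) * ∑ x : ι → Bool, ∑ y : ι → Bool, ∑ m : ι → Bool, wt p x * wt p y * wt (fun _ => b) m
        * ((f (update x i true) - f (update x i false))
          * (f (update (fun j => if m j = true then y j else x j) i true)
            - f (update (fun j => if m j = true then y j else x j) i false)))
      ≤ ∑ i, p i * (1 - p i) * ∑ x : ι → Bool, ∑ y : ι → Bool, ∑ m : ι → Bool, wt p x * wt p y * wt (fun _ => a) m
        * ((f (update x i true) - f (update x i false))
          * (f (update (fun j => if m j = true then y j else x j) i true)
            - f (update (fun j => if m j = true then y j else x j) i false))) := by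
  rw [pivotal_autocorrelation_eq_sum_coeff_sq p h0 h1 f a, pivotal_autocorrelation_eq_sum_coeff_sq p h0 h1 f b]
  refine Finset.sum_le_sum fun S _ => mul_le_mul_of_nonneg_left ?_ (Nat.cast_nonneg _)
  refine mul_le_mul_of_nonneg_right ?_ (sq_nonneg _)
  exact pow_le_pow_left₀ (by linarith) (by linarith) _

/-- **ENDPOINT `ε = 0`: THE TOTAL INFLUENCE** — `J_f(0) = Σ_i p_i(1−p_i)·E[(D_i f)²]` (at noise `0` the copy is `ω` itself).
[cite: ODonnell2014, §8.4 Prop 8.45 (I[f] = Σ_i σ_i² E[(D_i f)²])] -/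
theorem pivotal_autocorrelation_zero (f : (ι → Bool) → ℝ) :
    ∑ i, p i * (1 - p i) * ∑ x : ι → Bool, ∑ y : ι → Bool, ∑ m : ι → Bool, wt p x * wt p y * wt (fun _ => (0 : ℝ)) m
        * ((f (update x i true) - f (update x i false))
          * (f (update (fun j => if m j = true then y j else x j) i true)
            - f (update (fun j => if m j = true then y j else x j) i false)))
      = ∑ i, p i * (1 - p i) * ∑ x : ι → Bool, wt p x * (f (update x i true) - f (update x i false)) ^ 2 := by
  refine Finset.sum_congr rfl fun i _ => ?_
  congr 1
  have h := noise_zero_eq p (fun z => f (update z i true) - f (update z i false)) (fun z => f (update z i true) - f (update z i false))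
  rw [h]
  exact Finset.sum_congr rfl fun x _ => by ring

/-- **ENDPOINT `ε = 1`: THE LEVEL-1 WEIGHT** — `J_f(1) = Σ_i p_i(1−p_i)·E[D_i f]²` (at noise `1` the copy is independent; `p_i(1−p_i)E[D_i f]² = f̂(i)²`).
[cite: ODonnell2014, §8.4 Prop 8.45 (f̂(i) = σ E[D_i f])] -/
theorem pivotal_autocorrelation_one (f : (ι → Bool) → ℝ) :
    ∑ i, p i * (1 - p i) * ∑ x : ι → Bool, ∑ y : ι → Bool, ∑ m : ι → Bool, wt p x * wt p y * wt (fun _ => (1 : ℝ)) m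
        * ((f (update x i true) - f (update x i false))
          * (f (update (fun j => if m j = true then y j else x j) i true)
            - f (update (fun j => if m j = true then y j else x j) i false)))
      = ∑ i, p i * (1 - p i) * (∑ x : ι → Bool, wt p x * (f (update x i true) - f (update x i false))) ^ 2 := by
  refine Finset.sum_congr rfl fun i _ => ?_
  congr 1
  have h := noise_one_eq p (fun z => f (update z i true) - f (update z i false)) (fun z => f (update z i true) - f (update z i false))
  rw [h, sq]

include h0 h1 in
/-- **THE LEVEL-1 INEQUALITY AS THE `ε = 1` END**: `Σ_i p_i(1−p_i)·E[D_i f]² ≤ E[f²] − E[f]²` for every real `f` and every `p ∈ [0,1]^ι`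
(for an increasing event of the lattice cube: `p(1−p)·Σ_e P(e piv A)² ≤ u(1−u)`). [cite: ODonnell2014, §2.3 (W¹[f] ≤ Var f)] -/
theorem level_one_weight_le_var (f : (ι → Bool) → ℝ) :
    ∑ i, p i * (1 - p i) * (∑ x : ι → Bool, wt p x * (f (update x i true) - f (update x i false))) ^ 2
      ≤ ∑ x : ι → Bool, wt p x * (f x * f x) - (∑ x : ι → Bool, wt p x * f x) ^ 2 := by
  rw [var_eq_integral_pivotal_autocorrelation p h0 h1 f, ← pivotal_autocorrelation_one p f]
  -- the integrand dominates its value at `ε = 1` on `[0,1]`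
  have hconst := intervalIntegral.integral_const (a := (0 : ℝ)) (b := 1)
    (∑ i, p i * (1 - p i) * ∑ x : ι → Bool, ∑ y : ι → Bool, ∑ m : ι → Bool, wt p x * wt p y * wt (fun _ => (1 : ℝ)) m
        * ((f (update x i true) - f (update x i false))
          * (f (update (fun j => if m j = true then y j else x j) i true)
            - f (update (fun j => if m j = true then y j else x j) i false))))
  simp only [sub_zero, one_smul] at hconst
  rw [← hconst]
  refine intervalIntegral.integral_mono_on zero_le_one intervalIntegrable_const ?_ fun ε hε =>
    pivotal_autocorrelation_antitone p h0 h1 f hε.2 le_rfl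
  -- integrability of the (polynomial) integrand
  have hpoly : ∀ ε : ℝ, (∑ i, p i * (1 - p i) * ∑ x : ι → Bool, ∑ y : ι → Bool, ∑ m : ι → Bool, wt p x * wt p y * wt (fun _ => ε) m
        * ((f (update x i true) - f (update x i false))
          * (f (update (fun j => if m j = true then y j else x j) i true)
            - f (update (fun j => if m j = true then y j else x j) i false))))
      = ∑ S ∈ (Finset.univ : Finset ι).powerset, (S.card : ℝ) * ((1 - ε) ^ (S.card - 1)
          * (∑ x : ι → Bool, wt p x * (f x * ∏ j ∈ S,
              (((if x j then (1 : ℝ) else 0) - p j) / Real.sqrt (p j * (1 - p j))))) ^ 2) :=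
    fun ε => pivotal_autocorrelation_eq_sum_coeff_sq p h0 h1 f ε
  rw [show (fun ε : ℝ => ∑ i, p i * (1 - p i) * ∑ x : ι → Bool, ∑ y : ι → Bool, ∑ m : ι → Bool, wt p x * wt p y * wt (fun _ => ε) m
        * ((f (update x i true) - f (update x i false))
          * (f (update (fun j => if m j = true then y j else x j) i true)
            - f (update (fun j => if m j = true then y j else x j) i false))))
      = fun ε => ∑ S ∈ (Finset.univ : Finset ι).powerset, (S.card : ℝ) * ((1 - ε) ^ (S.card - 1)
          * (∑ x : ι → Bool, wt p x * (f x * ∏ j ∈ S,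
              (((if x j then (1 : ℝ) else 0) - p j) / Real.sqrt (p j * (1 - p j))))) ^ 2) from funext hpoly]
  exact (continuous_finsetSum _ fun S _ => by fun_prop).intervalIntegrable 0 1

include h0 h1 in
/-- **THE POINCARÉ–EFRON–STEIN INEQUALITY AS THE `ε = 0` END**: `E[f²] − E[f]² ≤ Σ_i p_i(1−p_i)·E[(D_i f)²]` for every real `f` and every
`p ∈ [0,1]^ι` (for an increasing event of the lattice cube: `u(1−u) ≤ p(1−p)·E[N_piv(A)]`).
[cite: ODonnell2014, §2.3 (Poincaré inequality Var f ≤ I[f]) and §8.4] [cite: EfronStein1981, Thm 1] -/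
theorem var_le_total_influence (f : (ι → Bool) → ℝ) :
    ∑ x : ι → Bool, wt p x * (f x * f x) - (∑ x : ι → Bool, wt p x * f x) ^ 2
      ≤ ∑ i, p i * (1 - p i) * ∑ x : ι → Bool, wt p x * (f (update x i true) - f (update x i false)) ^ 2 := by
  rw [var_eq_integral_pivotal_autocorrelation p h0 h1 f, ← pivotal_autocorrelation_zero p f]
  have hconst := intervalIntegral.integral_const (a := (0 : ℝ)) (b := 1)
    (∑ i, p i * (1 - p i) * ∑ x : ι → Bool, ∑ y : ι → Bool, ∑ m : ι → Bool, wt p x * wt p y * wt (fun _ => (0 : ℝ)) m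
        * ((f (update x i true) - f (update x i false))
          * (f (update (fun j => if m j = true then y j else x j) i true)
            - f (update (fun j => if m j = true then y j else x j) i false))))
  simp only [sub_zero, one_smul] at hconst
  rw [← hconst]
  refine intervalIntegral.integral_mono_on zero_le_one ?_ intervalIntegrable_const fun ε hε =>
    pivotal_autocorrelation_antitone p h0 h1 f hε.1 hε.2
  have hpoly : ∀ ε : ℝ, (∑ i, p i * (1 - p i) * ∑ x : ι → Bool, ∑ y : ι → Bool, ∑ m : ι → Bool, wt p x * wt p y * wt (fun _ => ε) m
        * ((f (update x i true) - f (update x i false))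
          * (f (update (fun j => if m j = true then y j else x j) i true)
            - f (update (fun j => if m j = true then y j else x j) i false))))
      = ∑ S ∈ (Finset.univ : Finset ι).powerset, (S.card : ℝ) * ((1 - ε) ^ (S.card - 1)
          * (∑ x : ι → Bool, wt p x * (f x * ∏ j ∈ S,
              (((if x j then (1 : ℝ) else 0) - p j) / Real.sqrt (p j * (1 - p j))))) ^ 2) :=
    fun ε => pivotal_autocorrelation_eq_sum_coeff_sq p h0 h1 f ε
  rw [show (fun ε : ℝ => ∑ i, p i * (1 - p i) * ∑ x : ι → Bool, ∑ y : ι → Bool, ∑ m : ι → Bool, wt p x * wt p y * wt (fun _ => ε) m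
        * ((f (update x i true) - f (update x i false))
          * (f (update (fun j => if m j = true then y j else x j) i true)
            - f (update (fun j => if m j = true then y j else x j) i false))))
      = fun ε => ∑ S ∈ (Finset.univ : Finset ι).powerset, (S.card : ℝ) * ((1 - ε) ^ (S.card - 1)
          * (∑ x : ι → Bool, wt p x * (f x * ∏ j ∈ S,
              (((if x j then (1 : ℝ) else 0) - p j) / Real.sqrt (p j * (1 - p j))))) ^ 2) from funext hpoly]
  exact (continuous_finsetSum _ fun S _ => by fun_prop).intervalIntegrable 0 1

end Summit.CriticalPhenomena.PercolationContinuityZ3.Theorems.Crossing.Spectral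

end
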